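import Literature.Combinatorics.Optimization.SosConeSemidefiniteExtensionDegree
import Literature.Combinatorics.Optimization.PsdFactorizationRankOneBlowup
import HarnessLib

/-!
# The degree-two moment cone and the completely positive cone (Averkov 2019, Cor. 15 for `d = 1`; Cor. 16, dual half)

G. Averkov, *Optimal size of linear matrix inequalities in semidefinite approaches to polynomial
optimization*, SIAM J. Appl. Algebra Geom. **3** (2019) 128–151 = arXiv:1806.08656 [cite: Averkov2019]
(held text `paper:arxiv-1806.08656`, arXiv page numbering), p06, verbatim:

"We introduce the moment cones `M_{n,2d} := cl(cone({v_{n,2d}(x) : x ∈ ℝⁿ}))`,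
`M_{n,2d}(X) := cl(cone({v_{n,2d}(x) : x ∈ X}))` … **Corollary 15.**
`sxd(M_{n,2d}) = sxc(M_{n,2d}) = ∞` if `n, d ≥ 2, (n,d) ≠ (2,2)`; `binom(n+d, n)` otherwise."
"The cone `CP_k := {A ∈ S^k : xᵀAx ≥ 0 for all x ∈ ℝ^k_+}` is known as the cone of copositive matrices
of size `k`. Its dual cone `CP_k^*` is the closed convex cone generated by rank-one positive semidefinite
matrices `xxᵀ` with `x ∈ ℝ^k_+` [printed `ℝ^n_+`]. Elements of `CP_k^*` are called completely positive
matrices. … **Corollary 16.** One has `sxd(CP_k) = sxd(CP_k^*) ≥ k`, and the equality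
`sxd(CP_k) = sxd(CP_k^*) = k` holds if `k ≤ 4`."

Both corollaries are obtained in print by the duality `sxd(C^*) = sxd(C)` (2.2). This file PROVES, without
that duality and in the vocabulary of `SosConeSemidefiniteExtensionDegree.lean` (`momentCone n D X =
M_{n,D}(X)`, `SosCone.momentVector`, `SosCone.Idx`, `HasBlockPsdLift`, `HasPsdLift`):

* **Corollary 15, the case `d = 1` (every `n`): `sxd(M_{n,2}) = sxc(M_{n,2}) = n + 1`** —
  `isLeast_blockSize_hasBlockPsdLift_momentCone_two`, `isLeast_size_hasPsdLift_momentCone_two`. The lower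
  bound is the tree's Corollary 14 (`not_hasBlockPsdLift_momentCone`, `binom(n+1,n) = n+1`); the upper
  bound is the DEGREE-TWO MOMENT MATRIX: `M_{n,2} = {y : M(y) ⪰ 0}` (`mem_momentCone_two_iff_posSemidef`),
  indeed `M_{n,2}` is a linear image of `S^{n+1}_+` (`momentCone_two_eq_image_posSemidef`), so one LMI of
  size `n + 1` lifts it (`hasBlockPsdLift_momentCone_two`). Proof of the identification: `M(v(x)) =
  (1,x)(1,x)ᵀ ⪰ 0` and `S^{n+1}_+` is a closed convex cone; conversely a psd `P` is `Σ_i b_i b_iᵀ` (psd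
  square root) and `b bᵀ ↦ hv b ∈ M_{n,2}`: for `b_0 ≠ 0` it is `b_0² v(b'/b_0)`, for `b_0 = 0` it is
  the limit of `ε² v(b'/ε)` — this is where the CLOSURE in Averkov's definition is used.
* **Corollary 16, the completely positive half: `sxd(CP_k^*) ≥ k`** — `completelyPositiveCone k` (as
  printed: the closure of the conic hull of `{xxᵀ : x ∈ ℝ^k_+}`), **`not_hasBlockPsdLift_completelyPositiveCone`**
  (`CP_k^*` has no `(S^K_+)^m`-lift for `K < k`, any `m`), `le_of_hasBlockPsdLift_completelyPositiveCone`,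
  `mem_lowerBounds_blockSize_hasBlockPsdLift_completelyPositiveCone`. Proof: the same moment-matrix
  identification gives `ofMatrix(CP_{n+1}^*) = M_{n,2}(ℝⁿ_+)` EXACTLY (`image_ofMatrix_completelyPositiveCone`;
  this is the dual side of Averkov's `CP_k ≅ P_{k-1,2}(ℝ^{k-1}_+)`, p13), `ofMatrix` linear, so a lift of
  `CP_{n+1}^*` is a lift of `M_{n,2}(ℝⁿ_+)`, excluded below size `n + 1` by Corollary 14
  (`int ℝⁿ_+ ≠ ∅`). The copositive half `sxd(CP_k) ≥ k` is `CopositiveConeExtensionDegree.lean`.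

Infrastructure (namespace `MomentTwo`): `pairExp a b` (exponent of `w_a w_b`, `w = (1, x)`), the
homogenised moment vector `hv u` with `hv u (pairExp a b) = u_a u_b`, `hv (1,x) = v_{n,2}(x)`,
`hv (c u) = c² hv u`; the moment matrix `momentMatrix n : ℝ^{binom(n+2,2)} →ₗ S^{n+1}`,
`momentMatrix (hv u) = u uᵀ`; a linear left inverse `ofMatrix n` (`ofMatrix ∘ momentMatrix = id`,
`ofMatrix (u uᵀ) = hv u`, and `momentMatrix ∘ ofMatrix = id` on `CP^*`); cone lemmas for `M_{n,D}(X)`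
(`zero/add/sum_mem_momentCone`, `isClosed_momentCone`) and for `CP_k^*`; `CP_k^* ⊆ S^k_+`
(`posSemidef_of_mem_completelyPositiveCone`); `S^k_+ ∋ P = Σ_i b_i b_iᵀ` is the tree's
`exists_eq_sum_vecMulVec_of_posSemidef` (`PsdFactorizationRankOneBlowup.lean`).

NOT here: Corollary 15 for `n = 1` (`sxd(M_{1,2d}) = d + 1`: the upper bound needs the Hankel form of the
truncated Hamburger moment problem / the bipolar theorem), the infinite cases (Scheiderer's Theorem 13),
the equality `sxd(CP_k^*) = k` for `k ≤ 4` (Diananda), and the duality (2.2) itself. Whether `CP_k^*`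
has any semidefinite lift for `k > 4` is open (p06). Everything here is proved; no named fact.
-/

noncomputable section

open Finset Matrix
open scoped MatrixOrder

namespace Literature.Combinatorics.Optimization

open SosCone

namespace MomentTwo

variable {n : ℕ}

/-! ### §1 Degree-two exponent vectors as pairs of homogeneous coordinates -/

/-- The indicator exponent of the homogeneous coordinate `w_a` (`w_0 = 1`, `w_{j+1} = x_j`): `0` for `a = 0`,
`e_j` for `a = j + 1`. [folklore] -/
def ind (a : Fin (n + 1)) (i : Fin n) : ℕ := if i.succ = a then 1 else 0

/-- `ind 0 = 0`. [folklore] -/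
@[simp] private theorem ind_zero (i : Fin n) : ind (0 : Fin (n + 1)) i = 0 := by
  simp [ind, Fin.succ_ne_zero]

/-- `ind (j+1) = e_j`. [folklore] -/
@[simp] private theorem ind_succ (j i : Fin n) : ind j.succ i = if i = j then 1 else 0 := by
  simp [ind, Fin.succ_inj]

/-- `Σ_i ind a i ≤ 1`. [folklore] -/
private theorem sum_ind_le (a : Fin (n + 1)) : ∑ i, ind a i ≤ 1 := by
  refine Fin.cases ?_ (fun j => ?_) a
  · simp
  · simp [Finset.sum_ite_eq']

/-- `ind a i ≤ 1`. [folklore] -/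
private theorem ind_le_one (a : Fin (n + 1)) (i : Fin n) : ind a i ≤ 1 := by
  unfold ind; split_ifs <;> omega

/-- `ind a i + ind b i < 3`. [folklore] -/
private theorem ind_add_ind_lt (a b : Fin (n + 1)) (i : Fin n) : ind a i + ind b i < 3 := by
  have := ind_le_one a i; have := ind_le_one b i; omega

/-- `Σ_i (ind a i + ind b i) ≤ 2`. [folklore] -/
private theorem sum_ind_add_ind_le (a b : Fin (n + 1)) : ∑ i, (ind a i + ind b i) ≤ 2 := by
  rw [sum_add_distrib]
  have := sum_ind_le a; have := sum_ind_le b; omega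

/-- **The exponent vector of the monomial `w_a w_b`** (degree `≤ 2` in `x`). [cite: Averkov2019, Remark 23 (p10)] -/
def pairExp (a b : Fin (n + 1)) : Idx n 2 :=
  ⟨fun i => ⟨ind a i + ind b i, ind_add_ind_lt a b i⟩, sum_ind_add_ind_le a b⟩

/-- Components of `pairExp`. [folklore] -/
@[simp] private theorem pairExp_apply_val (a b : Fin (n + 1)) (i : Fin n) :
    ((pairExp a b).1 i : ℕ) = ind a i + ind b i := rfl

/-- Every exponent vector of degree `≤ 1` is an indicator exponent. [folklore] -/
private theorem exists_ind_eq (α : Idx n 1) : ∃ a : Fin (n + 1), ∀ i, ind a i = (α.1 i : ℕ) := by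
  by_cases h : ∃ j, (α.1 j : ℕ) = 1
  · obtain ⟨j, hj⟩ := h
    refine ⟨j.succ, fun i => ?_⟩
    rw [ind_succ]
    by_cases hij : i = j
    · rw [if_pos hij, hij, hj]
    · rw [if_neg hij]
      -- `α i + α j ≤ Σ α ≤ 1` forces `α i = 0`
      have hsum : (α.1 i : ℕ) + (α.1 j : ℕ) ≤ ∑ k, (α.1 k : ℕ) := by
        rw [← sum_pair (f := fun k => (α.1 k : ℕ)) hij]
        exact sum_le_sum_of_subset_of_nonneg (subset_univ _) fun _ _ _ => Nat.zero_le _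
      have := α.2
      omega
  · refine ⟨0, fun i => ?_⟩
    rw [ind_zero]
    have h2 := (α.1 i).2
    have hne : (α.1 i : ℕ) ≠ 1 := fun hi => h ⟨i, hi⟩
    omega

/-- **Every exponent vector of degree `≤ 2` is `pairExp a b` for some pair** (no uniqueness claimed).
[cite: Averkov2019, (1.1) (p03)] -/
theorem exists_pairExp_eq (γ : Idx n 2) : ∃ p : Fin (n + 1) × Fin (n + 1), pairExp p.1 p.2 = γ := by
  obtain ⟨α, β, hαβ⟩ := Idx.exists_add_eq (d := 1) γ
  obtain ⟨a, ha⟩ := exists_ind_eq α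
  obtain ⟨b, hb⟩ := exists_ind_eq β
  refine ⟨(a, b), Subtype.ext (funext fun i => Fin.ext ?_)⟩
  rw [pairExp_apply_val, ha, hb, hαβ]

/-- A chosen pair of homogeneous coordinates representing each exponent of degree `≤ 2`. [folklore] -/
def rep (γ : Idx n 2) : Fin (n + 1) × Fin (n + 1) := Classical.choose (exists_pairExp_eq γ)

/-- The chosen pair represents `γ`. [folklore] -/
private theorem pairExp_rep (γ : Idx n 2) : pairExp (rep γ).1 (rep γ).2 = γ := Classical.choose_spec (exists_pairExp_eq γ)

/-! ### §2 The homogenised degree-two moment vector and the moment matrix -/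

/-- **The homogenised moment vector** `(u^α u_0^{2−|α|})_{|α| ≤ 2}` of `u = (u_0, u_1, …, u_n)`: for `u_0 = 1`
this is `v_{n,2}(u_1, …, u_n)`. [cite: Averkov2019, Remark 30 (p12, "appending a component 1")] -/
def hv (u : Fin (n + 1) → ℝ) (γ : Idx n 2) : ℝ :=
  u 0 ^ (2 - ∑ i, (γ.1 i : ℕ)) * ∏ i, u i.succ ^ (γ.1 i : ℕ)

/-- `Π_i u_{i+1}^{ind a i} = w_a` (with `w_0 = 1`). [folklore] -/
private theorem prod_pow_ind (u : Fin (n + 1) → ℝ) (a : Fin (n + 1)) :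
    ∏ i, u i.succ ^ ind a i = Fin.cases (motive := fun _ => ℝ) 1 (fun j => u j.succ) a := by
  refine Fin.cases ?_ (fun j => ?_) a
  · simp
  · simp only [ind_succ, Fin.cases_succ]
    rw [Finset.prod_eq_single j]
    · simp
    · intro i _ hi; rw [if_neg hi, pow_zero]
    · simp

/-- `Σ_i ind a i = [a ≠ 0]`. [folklore] -/
private theorem sum_ind (a : Fin (n + 1)) :
    ∑ i, ind a i = Fin.cases (motive := fun _ => ℕ) 0 (fun _ => 1) a := by
  refine Fin.cases ?_ (fun j => ?_) a
  · simp
  · simp [Finset.sum_ite_eq']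

/-- **Key identity: `hv u` at the exponent of `w_a w_b` is `u_a u_b`.** [cite: Averkov2019, (1.1) (p03)] -/
theorem hv_pairExp (u : Fin (n + 1) → ℝ) (a b : Fin (n + 1)) : hv u (pairExp a b) = u a * u b := by
  unfold hv
  simp only [pairExp_apply_val, pow_add, prod_mul_distrib, sum_add_distrib, prod_pow_ind, sum_ind]
  refine Fin.cases ?_ (fun j => ?_) a <;> refine Fin.cases ?_ (fun k => ?_) b <;> simp <;> ring

/-- `hv (1, x) = v_{n,2}(x)`. [cite: Averkov2019, Remark 30 (p12)] -/
theorem hv_cons_one (x : Fin n → ℝ) : hv (Fin.cons 1 x) = momentVector 2 x := by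
  funext γ
  simp [hv, momentVector]

/-- `hv u` at `γ` is the product of the two homogeneous coordinates representing `γ`. [folklore] -/
private theorem hv_eq (u : Fin (n + 1) → ℝ) (γ : Idx n 2) : hv u γ = u (rep γ).1 * u (rep γ).2 := by
  conv_lhs => rw [← pairExp_rep γ]
  exact hv_pairExp u _ _

/-- `hv` is homogeneous of degree two: `hv (c u) = c² hv u`. [folklore] -/
private theorem hv_smul (c : ℝ) (u : Fin (n + 1) → ℝ) : hv (c • u) = c ^ 2 • hv u := by
  funext γ
  simp only [hv_eq, Pi.smul_apply, smul_eq_mul]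
  ring

/-- `hv (−u) = hv u`. [folklore] -/
private theorem hv_neg (u : Fin (n + 1) → ℝ) : hv (-u) = hv u := by
  have h := hv_smul (-1) u
  rwa [neg_one_smul, neg_one_sq, one_smul] at h

/-- `hv` is continuous in `u`. [folklore] -/
private theorem continuous_hv : Continuous (hv : (Fin (n + 1) → ℝ) → Idx n 2 → ℝ) := by
  have h : (hv : (Fin (n + 1) → ℝ) → Idx n 2 → ℝ) = fun u γ => u (rep γ).1 * u (rep γ).2 := by
    funext u γ; exact hv_eq u γ
  rw [h]
  exact continuous_pi fun γ => (continuous_apply _).mul (continuous_apply _)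

/-- **The degree-two moment matrix** `M(y)_{ab} = y_{α(a)+α(b)}` (rows and columns indexed by the monomials
`1, x_1, …, x_n`), a linear map `ℝ^{binom(n+2,2)} → S^{n+1}`. [cite: Averkov2019, (1.1) (p03)] -/
def momentMatrix (n : ℕ) : (Idx n 2 → ℝ) →ₗ[ℝ] Matrix (Fin (n + 1)) (Fin (n + 1)) ℝ where
  toFun y := Matrix.of fun a b => y (pairExp a b)
  map_add' y z := by ext a b; rfl
  map_smul' c y := by ext a b; rfl

/-- Entries of the moment matrix. [cite: Averkov2019, (1.1) (p03)] -/
@[simp] theorem momentMatrix_apply (y : Idx n 2 → ℝ) (a b : Fin (n + 1)) :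
    momentMatrix n y a b = y (pairExp a b) := rfl

/-- **`M(hv u) = u uᵀ`**: the moment matrix of a homogenised moment vector is rank one.
[cite: Averkov2019, (1.1) (p03)] -/
theorem momentMatrix_hv (u : Fin (n + 1) → ℝ) : momentMatrix n (hv u) = vecMulVec u u := by
  ext a b
  rw [momentMatrix_apply, hv_pairExp, vecMulVec_apply]

/-- `M(v_{n,2}(x)) = (1,x)(1,x)ᵀ`. [cite: Averkov2019, (1.1) (p03)] -/
theorem momentMatrix_momentVector (x : Fin n → ℝ) :
    momentMatrix n (momentVector 2 x) = vecMulVec (Fin.cons 1 x) (Fin.cons 1 x) := by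
  rw [← hv_cons_one, momentMatrix_hv]

/-- **A linear left inverse of the moment matrix**: read the entry at a representing pair.
[cite: Averkov2019, (1.1) (p03)] -/
def ofMatrix (n : ℕ) : Matrix (Fin (n + 1)) (Fin (n + 1)) ℝ →ₗ[ℝ] (Idx n 2 → ℝ) where
  toFun M γ := M (rep γ).1 (rep γ).2
  map_add' M N := by funext γ; rfl
  map_smul' c M := by funext γ; rfl

/-- Entries of `ofMatrix`. [folklore] -/
@[simp] private theorem ofMatrix_apply (M : Matrix (Fin (n + 1)) (Fin (n + 1)) ℝ) (γ : Idx n 2) :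
    ofMatrix n M γ = M (rep γ).1 (rep γ).2 := rfl

/-- `ofMatrix ∘ M = id`. [cite: Averkov2019, (1.1) (p03)] -/
@[simp] theorem ofMatrix_momentMatrix (y : Idx n 2 → ℝ) : ofMatrix n (momentMatrix n y) = y := by
  funext γ
  rw [ofMatrix_apply, momentMatrix_apply, pairExp_rep]

/-- `ofMatrix (u uᵀ) = hv u`. [cite: Averkov2019, (1.1) (p03)] -/
theorem ofMatrix_vecMulVec (u : Fin (n + 1) → ℝ) : ofMatrix n (vecMulVec u u) = hv u := by
  rw [← momentMatrix_hv, ofMatrix_momentMatrix]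

/-- `M ∘ ofMatrix = id` on rank-one symmetric matrices. [cite: Averkov2019, (1.1) (p03)] -/
theorem momentMatrix_ofMatrix_vecMulVec (u : Fin (n + 1) → ℝ) :
    momentMatrix n (ofMatrix n (vecMulVec u u)) = vecMulVec u u := by
  rw [ofMatrix_vecMulVec, momentMatrix_hv]

end MomentTwo

open MomentTwo

variable {n : ℕ}

/-! ### §3 `M_{n,D}(X)` is a closed convex cone; the homogenised moment vectors it contains -/

/-- `0 ∈ M_{n,D}(X)`. [cite: Averkov2019, §2.1 (p06)] -/
theorem zero_mem_momentCone {n D : ℕ} (X : Set (Fin n → ℝ)) : (0 : Idx n D → ℝ) ∈ momentCone n D X :=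
  subset_closure (Submodule.zero_mem _)

/-- `M_{n,D}(X)` is closed under addition. [cite: Averkov2019, §2.1 (p06)] -/
theorem add_mem_momentCone {n D : ℕ} {X : Set (Fin n → ℝ)} {y z : Idx n D → ℝ} (hy : y ∈ momentCone n D X)
    (hz : z ∈ momentCone n D X) : y + z ∈ momentCone n D X :=
  map_mem_closure₂ continuous_add hy hz fun _ ha _ hb => Submodule.add_mem _ ha hb

/-- `M_{n,D}(X)` is closed. [cite: Averkov2019, §2.1 (p06)] -/
theorem isClosed_momentCone {n D : ℕ} (X : Set (Fin n → ℝ)) : IsClosed (momentCone n D X) := isClosed_closure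

/-- Finite sums of elements of `M_{n,D}(X)` lie in `M_{n,D}(X)`. [cite: Averkov2019, §2.1 (p06)] -/
theorem sum_mem_momentCone {n D : ℕ} {X : Set (Fin n → ℝ)} {ι : Type*} (s : Finset ι) (f : ι → Idx n D → ℝ)
    (h : ∀ i ∈ s, f i ∈ momentCone n D X) : ∑ i ∈ s, f i ∈ momentCone n D X :=
  Finset.sum_induction f (· ∈ momentCone n D X) (fun _ _ ha hb => add_mem_momentCone ha hb)
    (zero_mem_momentCone X) h

/-- **`hv u ∈ M_{n,2}(X)` when `u_0 > 0` and `u'/u_0 ∈ X`** (`hv u = u_0² v(u'/u_0)`).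
[cite: Averkov2019, Remark 30 (p12)] -/
theorem hv_mem_momentCone_of_pos {X : Set (Fin n → ℝ)} {u : Fin (n + 1) → ℝ} (h0 : 0 < u 0)
    (hX : (fun i => u i.succ / u 0) ∈ X) : hv u ∈ momentCone n 2 X := by
  have hu : u = u 0 • Fin.cons (1 : ℝ) (fun i => u i.succ / u 0) := by
    funext a
    refine Fin.cases ?_ (fun i => ?_) a
    · simp
    · simp only [Pi.smul_apply, Fin.cons_succ, smul_eq_mul]
      rw [mul_div_cancel₀ _ h0.ne']
  rw [hu, hv_smul, hv_cons_one]
  exact smul_mem_momentCone (momentVector_mem_momentCone hX) (sq_nonneg _)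

/-- **`hv u ∈ M_{n,2}(X)` when `u_0 = 0` and `u'/ε ∈ X` for all `ε > 0`** — the limit `ε → 0⁺` of
`hv(ε, u') = ε² v(u'/ε)` (the moment cone is closed). [cite: Averkov2019, §2.1 (p06, "cl")] -/
theorem hv_mem_momentCone_of_zero {X : Set (Fin n → ℝ)} {u : Fin (n + 1) → ℝ} (h0 : u 0 = 0)
    (hX : ∀ ε : ℝ, 0 < ε → (fun i => u i.succ / ε) ∈ X) : hv u ∈ momentCone n 2 X := by
  set e : Fin (n + 1) → ℝ := Pi.single 0 1 with he
  let f : ℝ → (Idx n 2 → ℝ) := fun ε => hv (u + ε • e)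
  have hf : Continuous f :=
    continuous_hv.comp (continuous_const.add (continuous_id.smul continuous_const))
  have hval0 : ∀ ε : ℝ, (u + ε • e) 0 = ε := fun ε => by
    simp [he, h0]
  have hvals : ∀ (ε : ℝ) (i : Fin n), (u + ε • e) i.succ = u i.succ := fun ε i => by
    simp [he, Fin.succ_ne_zero]
  have hmem : ∀ ε : ℝ, 0 < ε → f ε ∈ momentCone n 2 X := by
    intro ε hε
    refine hv_mem_momentCone_of_pos (by rw [hval0]; exact hε) ?_
    have : (fun i : Fin n => (u + ε • e) i.succ / (u + ε • e) 0) = fun i => u i.succ / ε := by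
      funext i; rw [hval0, hvals]
    rw [this]
    exact hX ε hε
  have hf0 : f 0 = hv u := by simp [f]
  have hlim : Filter.Tendsto f (nhdsWithin 0 (Set.Ioi 0)) (nhds (hv u)) := by
    rw [← hf0]
    exact (hf.tendsto 0).mono_left nhdsWithin_le_nhds
  exact (isClosed_momentCone X).mem_of_tendsto hlim
    (eventually_nhdsWithin_of_forall fun ε hε => hmem ε hε)

/-- `hv u ∈ M_{n,2} = M_{n,2}(ℝⁿ)` for every `u`. [cite: Averkov2019, §2.1 (p06)] -/
theorem hv_mem_momentCone_univ (u : Fin (n + 1) → ℝ) : hv u ∈ momentCone n 2 Set.univ := by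
  rcases lt_trichotomy (u 0) 0 with h | h | h
  · rw [← hv_neg]
    exact hv_mem_momentCone_of_pos (by simp only [Pi.neg_apply]; linarith) (Set.mem_univ _)
  · exact hv_mem_momentCone_of_zero h fun _ _ => Set.mem_univ _
  · exact hv_mem_momentCone_of_pos h (Set.mem_univ _)

/-- `hv u ∈ M_{n,2}(ℝⁿ_+)` for every `u ∈ ℝ^{n+1}_+`. [cite: Averkov2019, §2.1 (p06)] -/
theorem hv_mem_momentCone_orthant {u : Fin (n + 1) → ℝ} (hu : ∀ a, 0 ≤ u a) :
    hv u ∈ momentCone n 2 {x | ∀ i, 0 ≤ x i} := by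
  rcases (hu 0).eq_or_lt with h | h
  · exact hv_mem_momentCone_of_zero h.symm fun ε hε i => div_nonneg (hu _) hε.le
  · exact hv_mem_momentCone_of_pos h fun i => div_nonneg (hu _) h.le

/-! ### §4 `M_{n,2} ≅ S^{n+1}_+`: Corollary 15 for `d = 1` -/

/-- The positive semidefinite matrices form a closed set. [folklore] -/
private theorem isClosed_setOf_posSemidef (k : ℕ) :
    IsClosed {M : Matrix (Fin k) (Fin k) ℝ | M.PosSemidef} := by
  have h : {M : Matrix (Fin k) (Fin k) ℝ | M.PosSemidef} =
      (⋂ i, ⋂ j, {M | M j i = M i j}) ∩ ⋂ x : Fin k → ℝ, {M | 0 ≤ x ⬝ᵥ M *ᵥ x} := by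
    ext M
    simp only [Set.mem_setOf_eq, Set.mem_inter_iff, Set.mem_iInter]
    constructor
    · intro hM
      exact ⟨fun i j => by simpa using hM.1.apply i j, fun x => by simpa using hM.dotProduct_mulVec_nonneg x⟩
    · rintro ⟨h1, h2⟩
      exact PosSemidef.of_dotProduct_mulVec_nonneg (Matrix.IsHermitian.ext fun i j => by simpa using h1 i j)
        fun x => by simpa using h2 x
  rw [h]
  refine IsClosed.inter (isClosed_iInter fun i => isClosed_iInter fun j => ?_) (isClosed_iInter fun x => ?_)
  · exact isClosed_eq ((continuous_apply i).comp (continuous_apply j))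
      ((continuous_apply j).comp (continuous_apply i))
  · exact isClosed_le continuous_const
      (Continuous.dotProduct continuous_const (Continuous.matrix_mulVec continuous_id continuous_const))

/-- `u uᵀ ⪰ 0`. [folklore] -/
private theorem posSemidef_vecMulVec_self {k : ℕ} (u : Fin k → ℝ) : (vecMulVec u u).PosSemidef := by
  refine PosSemidef.of_dotProduct_mulVec_nonneg ?_ fun w => ?_
  · rw [IsHermitian, conjTranspose_eq_transpose_of_trivial, transpose_vecMulVec]
  · have h : vecMulVec u u *ᵥ w = (u ⬝ᵥ w) • u := by
      funext i
      simp only [mulVec, dotProduct, vecMulVec_apply, Pi.smul_apply, smul_eq_mul, sum_mul]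
      exact sum_congr rfl fun j _ => by ring
    rw [h, star_trivial, dotProduct_smul, smul_eq_mul, dotProduct_comm w u]
    exact mul_self_nonneg _

/-- **The moment matrix of every element of `M_{n,2}(X)` is positive semidefinite** (it is so on the
generators `v(x)`, `M(v(x)) = (1,x)(1,x)ᵀ`, and `S^{n+1}_+` is a closed convex cone).
[cite: Averkov2019, Lemma 32 (p13) with (1.1) (p03)] -/
theorem posSemidef_momentMatrix {X : Set (Fin n → ℝ)} {y : Idx n 2 → ℝ} (hy : y ∈ momentCone n 2 X) :
    (momentMatrix n y).PosSemidef := by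
  have hcl : IsClosed {z : Idx n 2 → ℝ | (momentMatrix n z).PosSemidef} :=
    (isClosed_setOf_posSemidef (n + 1)).preimage (momentMatrix n).continuous_of_finiteDimensional
  refine closure_minimal (fun z hz => ?_) hcl hy
  refine Submodule.span_induction (p := fun z _ => (momentMatrix n z).PosSemidef) ?_ ?_ ?_ ?_ hz
  · rintro _ ⟨x, -, rfl⟩
    rw [momentMatrix_momentVector]
    exact posSemidef_vecMulVec_self _
  · rw [map_zero]; exact PosSemidef.zero
  · intro a b _ _ ha hb
    rw [map_add]; exact ha.add hb
  · intro c a _ ha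
    change (momentMatrix n ((c : ℝ) • a)).PosSemidef
    rw [map_smul]; exact ha.smul c.2

/-- `ofMatrix P ∈ M_{n,2}` for `P ⪰ 0` (`P = Σ b_i b_iᵀ` and `ofMatrix (b bᵀ) = hv b ∈ M_{n,2}`).
[cite: Averkov2019, Cor. 15 (p06)] -/
theorem ofMatrix_mem_momentCone_of_posSemidef {P : Matrix (Fin (n + 1)) (Fin (n + 1)) ℝ}
    (hP : P.PosSemidef) : ofMatrix n P ∈ momentCone n 2 Set.univ := by
  obtain ⟨B, rfl⟩ := exists_eq_sum_vecMulVec_of_posSemidef hP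
  rw [map_sum]
  exact sum_mem_momentCone _ _ fun i _ => by rw [ofMatrix_vecMulVec]; exact hv_mem_momentCone_univ _

/-- **`M_{n,2} = ofMatrix(S^{n+1}_+)`**: the degree-two moment cone is a linear image of the psd cone of
size `n + 1` (the moment-matrix identification; the two cones are linearly isomorphic).
[cite: Averkov2019, Cor. 15 (p06) with (2.2) and Cor. 6] -/
theorem momentCone_two_eq_image_posSemidef (n : ℕ) :
    momentCone n 2 Set.univ = ofMatrix n '' {P : Matrix (Fin (n + 1)) (Fin (n + 1)) ℝ | P.PosSemidef} := by
  refine Set.Subset.antisymm (fun y hy => ?_) ?_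
  · exact ⟨momentMatrix n y, posSemidef_momentMatrix hy, ofMatrix_momentMatrix y⟩
  · rintro _ ⟨P, hP, rfl⟩
    exact ofMatrix_mem_momentCone_of_posSemidef hP

/-- **`y ∈ M_{n,2} ⟺ M(y) ⪰ 0`**: the closed moment cone of degree two is cut out by ONE linear matrix
inequality of size `n + 1` (the truncated moment problem of degree two). [cite: Averkov2019, Cor. 15 (p06)] -/
theorem mem_momentCone_two_iff_posSemidef (y : Idx n 2 → ℝ) :
    y ∈ momentCone n 2 Set.univ ↔ (momentMatrix n y).PosSemidef :=
  ⟨posSemidef_momentMatrix, fun h => by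
    rw [← ofMatrix_momentMatrix y]; exact ofMatrix_mem_momentCone_of_posSemidef h⟩

/-- **`M_{n,2}` has an `S^{n+1}_+`-lift** (one block of size `binom(n+1, n) = n + 1`): the upper bound of
Corollary 15 in the case `d = 1`. [cite: Averkov2019, Cor. 15 (p06)] -/
theorem hasBlockPsdLift_momentCone_two (n : ℕ) : HasBlockPsdLift (momentCone n 2 Set.univ) (n + 1) 1 := by
  rw [momentCone_two_eq_image_posSemidef]
  exact (SpectraplexNeighborly.hasBlockPsdLift_posSemidef_self (n + 1)).image (ofMatrix n)

/-- The orthant `ℝⁿ_+` has non-empty interior. [folklore] -/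
private theorem interior_orthant_nonempty (n : ℕ) :
    (interior {x : Fin n → ℝ | ∀ i, 0 ≤ x i}).Nonempty := by
  have hopen : IsOpen {x : Fin n → ℝ | ∀ i, 0 < x i} := by
    have h : {x : Fin n → ℝ | ∀ i, 0 < x i} = ⋂ i, (fun x : Fin n → ℝ => x i) ⁻¹' Set.Ioi 0 := by
      ext x; simp
    rw [h]
    exact isOpen_iInter_of_finite fun i => isOpen_Ioi.preimage (continuous_apply i)
  have hsub : {x : Fin n → ℝ | ∀ i, 0 < x i} ⊆ {x : Fin n → ℝ | ∀ i, 0 ≤ x i} :=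
    fun x hx i => (hx i).le
  refine ⟨fun _ => 1, interior_mono hsub ?_⟩
  rw [hopen.interior_eq]
  exact fun _ => one_pos

/-- **Averkov 2019, Corollary 15, the case `d = 1`: `sxd(M_{n,2}) = binom(n+1, n) = n + 1`** — the least
block size `k` for which the degree-two moment cone has an `(S^k_+)^m`-lift for some `m` is `n + 1`
(upper bound: the moment matrix; lower bound: Corollary 14, `not_hasBlockPsdLift_momentCone`).
[cite: Averkov2019, Cor. 15 (p06)] -/
theorem isLeast_blockSize_hasBlockPsdLift_momentCone_two (n : ℕ) :
    IsLeast {k : ℕ | ∃ m : ℕ, HasBlockPsdLift (momentCone n 2 Set.univ) k m} (n + 1) := by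
  refine ⟨⟨1, hasBlockPsdLift_momentCone_two n⟩, ?_⟩
  have h := mem_lowerBounds_blockSize_hasBlockPsdLift_momentCone (n := n) (d := 1) (X := Set.univ)
    (by rw [interior_univ]; exact Set.univ_nonempty)
  rw [Nat.choose_succ_self_right] at h
  exact h

/-- **Averkov 2019, Corollary 15, the case `d = 1`, one block: `sxc(M_{n,2}) = n + 1`.**
[cite: Averkov2019, Cor. 15 (p06)] -/
theorem isLeast_size_hasPsdLift_momentCone_two (n : ℕ) :
    IsLeast {k : ℕ | HasPsdLift (momentCone n 2 Set.univ) k} (n + 1) := by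
  refine ⟨hasBlockPsdLift_one_iff.1 (hasBlockPsdLift_momentCone_two n), fun k hk => ?_⟩
  exact (isLeast_blockSize_hasBlockPsdLift_momentCone_two n).2 ⟨1, hasBlockPsdLift_one_iff.2 hk⟩

/-! ### §5 The completely positive cone `CP_k^*` and the dual half of Corollary 16 -/

/-- **The completely positive cone `CP_k^*`**: "the closed convex cone generated by rank-one positive
semidefinite matrices `xxᵀ` with `x ∈ ℝ^k_+`. Elements of `CP_k^*` are called completely positive matrices."
[cite: Averkov2019, §2.1 (p06)] -/
def completelyPositiveCone (k : ℕ) : Set (Matrix (Fin k) (Fin k) ℝ) :=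
  closure (PointedCone.hull ℝ {P : Matrix (Fin k) (Fin k) ℝ | ∃ x : Fin k → ℝ, (∀ i, 0 ≤ x i) ∧ P = vecMulVec x x} :
    Set (Matrix (Fin k) (Fin k) ℝ))

/-- `xxᵀ ∈ CP_k^*` for `x ∈ ℝ^k_+`. [cite: Averkov2019, §2.1 (p06)] -/
theorem vecMulVec_mem_completelyPositiveCone {k : ℕ} {x : Fin k → ℝ} (hx : ∀ i, 0 ≤ x i) :
    vecMulVec x x ∈ completelyPositiveCone k :=
  subset_closure (PointedCone.subset_hull ⟨x, hx, rfl⟩)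

/-- `0 ∈ CP_k^*`. [cite: Averkov2019, §2.1 (p06)] -/
theorem zero_mem_completelyPositiveCone (k : ℕ) : (0 : Matrix (Fin k) (Fin k) ℝ) ∈ completelyPositiveCone k :=
  subset_closure (Submodule.zero_mem _)

/-- `CP_k^*` is closed under addition. [cite: Averkov2019, §2.1 (p06)] -/
theorem add_mem_completelyPositiveCone {k : ℕ} {P Q : Matrix (Fin k) (Fin k) ℝ}
    (hP : P ∈ completelyPositiveCone k) (hQ : Q ∈ completelyPositiveCone k) :
    P + Q ∈ completelyPositiveCone k :=
  map_mem_closure₂ continuous_add hP hQ fun _ ha _ hb => Submodule.add_mem _ ha hb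

/-- `CP_k^*` is closed under nonnegative scaling. [cite: Averkov2019, §2.1 (p06)] -/
theorem smul_mem_completelyPositiveCone {k : ℕ} {P : Matrix (Fin k) (Fin k) ℝ}
    (hP : P ∈ completelyPositiveCone k) {c : ℝ} (hc : 0 ≤ c) : c • P ∈ completelyPositiveCone k := by
  refine map_mem_closure (continuous_const_smul c) hP fun z hz => ?_
  exact PointedCone.smul_mem _ hc hz

/-- `CP_k^*` is closed. [cite: Averkov2019, §2.1 (p06)] -/
theorem isClosed_completelyPositiveCone (k : ℕ) : IsClosed (completelyPositiveCone k) := isClosed_closure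

/-- A property closed under the cone operations and limits holds on `CP_k^*` once it holds on the
generators `xxᵀ`, `x ≥ 0`. [folklore] -/
private theorem completelyPositiveCone_induction {k : ℕ} {S : Set (Matrix (Fin k) (Fin k) ℝ)} (hS : IsClosed S)
    (hgen : ∀ x : Fin k → ℝ, (∀ i, 0 ≤ x i) → vecMulVec x x ∈ S) (h0 : (0 : Matrix (Fin k) (Fin k) ℝ) ∈ S)
    (hadd : ∀ P ∈ S, ∀ Q ∈ S, P + Q ∈ S) (hsmul : ∀ (c : ℝ), 0 ≤ c → ∀ P ∈ S, c • P ∈ S) :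
    completelyPositiveCone k ⊆ S := by
  refine closure_minimal (fun P hP => ?_) hS
  refine Submodule.span_induction (p := fun P _ => P ∈ S) ?_ h0 (fun P Q _ _ hP hQ => hadd P hP Q hQ)
    (fun c P _ hP => ?_) hP
  · rintro _ ⟨x, hx, rfl⟩; exact hgen x hx
  · exact hsmul c c.2 P hP

/-- `CP_k^* ⊆ S^k_+`: completely positive matrices are positive semidefinite. [cite: Averkov2019, §2.1 (p06)] -/
theorem posSemidef_of_mem_completelyPositiveCone {k : ℕ} {P : Matrix (Fin k) (Fin k) ℝ}
    (hP : P ∈ completelyPositiveCone k) : P.PosSemidef :=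
  completelyPositiveCone_induction (S := {P : Matrix (Fin k) (Fin k) ℝ | P.PosSemidef})
    (isClosed_setOf_posSemidef k) (fun x _ => posSemidef_vecMulVec_self x) PosSemidef.zero
    (fun _ hP _ hQ => hP.add hQ) (fun _ hc _ hP => hP.smul hc) hP

/-- `M ∘ ofMatrix = id` on `CP_{n+1}^*` (it holds on the generators and the fixed set is a closed
subspace). [cite: Averkov2019, (1.1) (p03)] -/
theorem momentMatrix_ofMatrix_of_mem_completelyPositiveCone {P : Matrix (Fin (n + 1)) (Fin (n + 1)) ℝ}
    (hP : P ∈ completelyPositiveCone (n + 1)) : momentMatrix n (ofMatrix n P) = P := by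
  refine completelyPositiveCone_induction (S := {P | momentMatrix n (ofMatrix n P) = P}) ?_ ?_ ?_ ?_ ?_ hP
  · exact isClosed_eq (((momentMatrix n).continuous_of_finiteDimensional).comp
      (ofMatrix n).continuous_of_finiteDimensional) continuous_id
  · intro x _; exact momentMatrix_ofMatrix_vecMulVec x
  · show momentMatrix n (ofMatrix n 0) = 0
    rw [map_zero, map_zero]
  · intro P hP Q hQ
    show momentMatrix n (ofMatrix n (P + Q)) = P + Q
    rw [map_add, map_add, show momentMatrix n (ofMatrix n P) = P from hP,
      show momentMatrix n (ofMatrix n Q) = Q from hQ]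
  · intro c _ P hP
    show momentMatrix n (ofMatrix n (c • P)) = c • P
    rw [map_smul, map_smul, show momentMatrix n (ofMatrix n P) = P from hP]

/-- **`ofMatrix(CP_{n+1}^*) = M_{n,2}(ℝⁿ_+)`**: the completely positive cone is linearly identified with the
degree-two moment cone of the orthant (`(1,x)(1,x)ᵀ ↔ v_{n,2}(x)`, `x ≥ 0`; the boundary rays
`(0,u')(0,u')ᵀ` are limits). This is Averkov's `CP_k ≅ P_{k-1,2}(ℝ^{k-1}_+)` (p13) on the dual side.
[cite: Averkov2019, Cor. 16 (p06), proof (p13)] -/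
theorem image_ofMatrix_completelyPositiveCone (n : ℕ) :
    ofMatrix n '' completelyPositiveCone (n + 1) = momentCone n 2 {x | ∀ i, 0 ≤ x i} := by
  refine Set.Subset.antisymm ?_ ?_
  · rintro _ ⟨P, hP, rfl⟩
    refine completelyPositiveCone_induction (S := ofMatrix n ⁻¹' momentCone n 2 {x | ∀ i, 0 ≤ x i})
      ?_ ?_ ?_ ?_ ?_ hP
    · exact (isClosed_momentCone _).preimage (ofMatrix n).continuous_of_finiteDimensional
    · intro x hx
      rw [Set.mem_preimage, ofMatrix_vecMulVec]
      exact hv_mem_momentCone_orthant hx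
    · rw [Set.mem_preimage, map_zero]; exact zero_mem_momentCone _
    · intro P hP Q hQ
      rw [Set.mem_preimage] at hP hQ ⊢
      rw [map_add]; exact add_mem_momentCone hP hQ
    · intro c hc P hP
      rw [Set.mem_preimage] at hP ⊢
      rw [map_smul]; exact smul_mem_momentCone hP hc
  · have himg : ofMatrix n '' completelyPositiveCone (n + 1) =
        momentMatrix n ⁻¹' completelyPositiveCone (n + 1) := by
      ext y
      constructor
      · rintro ⟨P, hP, rfl⟩
        rwa [Set.mem_preimage, momentMatrix_ofMatrix_of_mem_completelyPositiveCone hP]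
      · intro hy
        exact ⟨momentMatrix n y, hy, ofMatrix_momentMatrix y⟩
    rw [himg]
    refine closure_minimal (fun z hz => ?_)
      ((isClosed_completelyPositiveCone _).preimage (momentMatrix n).continuous_of_finiteDimensional)
    refine Submodule.span_induction (p := fun z _ => momentMatrix n z ∈ completelyPositiveCone (n + 1))
      ?_ ?_ ?_ ?_ hz
    · rintro _ ⟨x, hx, rfl⟩
      rw [momentMatrix_momentVector]
      exact vecMulVec_mem_completelyPositiveCone fun a => Fin.cases (by simp) (fun i => by simpa using hx i) a
    · rw [map_zero]; exact zero_mem_completelyPositiveCone _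
    · intro a b _ _ ha hb
      rw [map_add]; exact add_mem_completelyPositiveCone ha hb
    · intro c a _ ha
      change momentMatrix n ((c : ℝ) • a) ∈ _
      rw [map_smul]; exact smul_mem_completelyPositiveCone ha c.2

/-- **Averkov 2019, Corollary 16, the completely positive cone: `sxd(CP_k^*) ≥ k`** — `CP_k^*` has no
`(S^K_+)^m`-lift for `K < k`, whatever `m` (the expressive power of LMIs of size `< k` does not suffice for
completely positive programming of order `k`). Printed proof: (2.2) `sxd(C^*) = sxd(C)` and `sxd(CP_k) ≥ k`;
here directly: a lift of `CP_k^*` is carried by the linear map `ofMatrix` to a lift of `M_{k-1,2}(ℝ^{k-1}_+)`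
(`image_ofMatrix_completelyPositiveCone`), excluded by Corollary 14 (`not_hasBlockPsdLift_momentCone`,
`int ℝ^{k-1}_+ ≠ ∅`, `binom(k-1+1, k-1) = k`). [cite: Averkov2019, Cor. 16 (p06), proof (p13)] -/
theorem not_hasBlockPsdLift_completelyPositiveCone {k K : ℕ} (hK : K < k) (m : ℕ) :
    ¬ HasBlockPsdLift (completelyPositiveCone k) K m := by
  intro h
  obtain ⟨n, rfl⟩ : ∃ n, k = n + 1 := ⟨k - 1, by omega⟩
  have h' : HasBlockPsdLift (momentCone n 2 {x : Fin n → ℝ | ∀ i, 0 ≤ x i}) K m := by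
    rw [← image_ofMatrix_completelyPositiveCone]
    exact h.image (ofMatrix n)
  exact not_hasBlockPsdLift_momentCone (d := 1) (interior_orthant_nonempty n)
    (by rw [Nat.choose_succ_self_right]; exact hK) m h'

/-- Every block size lifting `CP_k^*` is `≥ k`. [cite: Averkov2019, Cor. 16 (p06)] -/
theorem le_of_hasBlockPsdLift_completelyPositiveCone {k K m : ℕ}
    (h : HasBlockPsdLift (completelyPositiveCone k) K m) : k ≤ K := by
  by_contra hlt
  exact not_hasBlockPsdLift_completelyPositiveCone (not_le.1 hlt) m h

/-- **`sxd(CP_k^*) ≥ k`** as a lower bound on the admissible block sizes (whether the set is non-empty,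
i.e. whether `CP_k^*` is semidefinitely representable at all for `k > 4`, is open — p06).
[cite: Averkov2019, Cor. 16 (p06)] -/
theorem mem_lowerBounds_blockSize_hasBlockPsdLift_completelyPositiveCone (k : ℕ) :
    k ∈ lowerBounds {K : ℕ | ∃ m : ℕ, HasBlockPsdLift (completelyPositiveCone k) K m} := by
  rintro K ⟨m, hm⟩
  exact le_of_hasBlockPsdLift_completelyPositiveCone hm

end Literature.Combinatorics.Optimization
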